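import Summits.AnomalousDissipation.AnomalousDissipation.Theorems.SolenoidalFractalHomogenisationRealisedQuasiStaticCellLawSlavedIsoSectorDecay
import Summits.AnomalousDissipation.AnomalousDissipation.Theorems.SolenoidalFractalHomogenisationRealisedQuasiStaticCellLawSlavedSectorDecayAE
import HarnessLib

/-!
# K2R `RealisedQuasiStaticCellLaw`, line `floquet-bloch`, stub `stub_lowSectorDecay` (S1D): a.e. energy decay of a
# weakly coupled low sector of the passive-vector cell evolution at an ISOTROPIC target rate (W-near regime)

Summits-side helper file (everything proved; no definitions, no named facts; `--supports stmt-AnomalousDissipation-20446`).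
`isoSector_exp_decay` (uniform-in-`N` decay of the truncation energies, per-period composition of the isotropic-pair
sector functionals) transferred to the weak solution exactly as `weakSector_decay_ae` transfers `slavedSector_exp_decay`
(`ae_integral_norm_sq_le_of_galerkinBound`): for every weak passive-vector solution `w` from `w₀` (sector `±ℓ + nℤ³`,
`2|ℓ| ≤ n`), a.e. in `t ∈ (0,T)`, `∫‖w(t)‖² ≤ β(∏_jΘ_j)⁻¹exp(−(log(∏Θ)⁻¹/P)t)∫‖w₀‖²`. All hypotheses are `N`-free: the
per-slot data for every `J : ℤ`, the weights `a_{q,j}, b_{q,j}, c_{q,j}` of the joint slow form for every period `q` with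
their co-moving derivatives, bounds, junction/start/end conditions (`isoSector_decay_ae`).
-/

set_option linter.dupNamespace false

noncomputable section

namespace Summit.AnomalousDissipation.AnomalousDissipation.Theorems.SolenoidalFractalHomogenisation.RealisedQuasiStaticCellLaw

open Set MeasureTheory Filter Topology Function Complex Matrix
open scoped InnerProductSpace ComplexConjugate Matrix
open Literature.Analysis Literature.Analysis.FunctionSpaces Literature.Analysis.FunctionSpaces.Torus
open Literature.Analysis.FluidPDE Literature.Analysis.FluidPDE.LatticeShear
open Summit.AnomalousDissipation.AnomalousDissipation.Theorems.SolenoidalFractalHomogenisation.PermissibleCarrier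

variable {k₀ : ℕ}

/-- **A.e. energy decay of a weakly coupled low sector at an isotropic target rate.** See the module docstring. -/
theorem isoSector_decay_ae (W : LatticeWord k₀) {n : ℕ} (hn : 0 < n) {κ : ℝ} (hκ : 0 < κ)
    (ℓ : Fin 3 → ℤ) (hℓn : 2 * ‖latticeVec ℓ‖ ≤ n) {w₀ : UnitAddTorus (Fin 3) → EuclideanSpace ℝ (Fin 3)}
    (hw₀ : FunctionSpaces.Torus.MemSobolev 1 (FunctionSpaces.EuclideanSpace.complexify ∘ w₀))
    (hdiv : FunctionSpaces.Torus.IsWeaklyDivFree w₀) (hmean : FunctionSpaces.Torus.HasZeroMean w₀)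
    (hsupp : ∀ k : Fin 3 → ℤ, ¬ ((∃ z : Fin 3 → ℤ, k = ℓ + (n:ℤ) • z) ∨ (∃ z : Fin 3 → ℤ, k = -ℓ + (n:ℤ) • z)) →
      UnitAddTorus.mFourierCoeff (FunctionSpaces.EuclideanSpace.complexify ∘ w₀) k = 0)
    (hk : ∀ j : Fin k₀, ∀ J : ℤ, ℓ + J • (fun i => (W.phase j).m i * (n : ℤ)) ≠ 0)
    (hdisj : ∀ j : Fin k₀, ∀ J J' : ℤ,
      ℓ + J • (fun i => (W.phase j).m i * (n : ℤ)) ≠ -(ℓ + J' • (fun i => (W.phase j).m i * (n : ℤ))))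
    (ζr : Fin k₀ → Fin 3 → ℝ) (hζ1 : ∀ j, ζr j ⬝ᵥ ζr j = 1) (hζ0 : ∀ j, ζr j ⬝ᵥ (fun i => ((ℓ i : ℤ) : ℝ)) = 0)
    (hζK : ∀ j, ζr j ⬝ᵥ (fun i => (((fun i => (W.phase j).m i * (n : ℤ)) i : ℤ) : ℝ)) = 0)
    (pf : Fin k₀ → ℤ → Fin 3 → ℝ)
    (hp : ∀ j, ∀ J : ℤ, pf j J = (Real.sqrt ((fun i => (((ℓ + J • (fun i => (W.phase j).m i * (n : ℤ))) i : ℤ) : ℝ)) ⬝ᵥ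
        (fun i => (((ℓ + J • (fun i => (W.phase j).m i * (n : ℤ))) i : ℤ) : ℝ))))⁻¹ •
        (fun i => (((ℓ + J • (fun i => (W.phase j).m i * (n : ℤ))) i : ℤ) : ℝ)) ⨯₃ ζr j)
    (hs : ∀ j, ∀ J : ℤ, |pf j J ⬝ᵥ pf j (J + 1)| ≤ 1)
    (Λ σo σi σ g₁ Θ : Fin k₀ → ℝ) (Δ ε β lam Gmax Gmin : ℝ)
    (wa wb : ℕ → Fin k₀ → ℝ → ℝ) (wc : ℕ → Fin k₀ → ℝ → ℂ)
    (hΛ : ∀ j, Λ j = κ * (4 * Real.pi ^ 2 * freqNormSq (fun i => (W.phase j).m i * (n : ℤ))))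
    (hΔ0 : 0 < Δ) (hε : 0 ≤ ε) (hβ : 1 ≤ β) (hlam : 0 ≤ lam) (hGmin : 0 < Gmin)
    (hgap : ∀ j, ∀ J : ℤ, J ≠ 0 →
      freqNormSq ℓ / freqNormSq (fun i => (W.phase j).m i * (n : ℤ)) + Δ ≤
        freqNormSq (ℓ + J • (fun i => (W.phase j).m i * (n : ℤ))) / freqNormSq (fun i => (W.phase j).m i * (n : ℤ)))
    (hσo : ∀ j, σo j = 1 / (freqNormSq (ℓ + (-1 : ℤ) • (fun i => (W.phase j).m i * (n : ℤ))) /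
          freqNormSq (fun i => (W.phase j).m i * (n : ℤ)) - freqNormSq ℓ / freqNormSq (fun i => (W.phase j).m i * (n : ℤ))) +
        1 / (freqNormSq (ℓ + (1 : ℤ) • (fun i => (W.phase j).m i * (n : ℤ))) /
          freqNormSq (fun i => (W.phase j).m i * (n : ℤ)) - freqNormSq ℓ / freqNormSq (fun i => (W.phase j).m i * (n : ℤ))))
    (hσi : ∀ j, σi j = (pf j (-1) ⬝ᵥ pf j 0) ^ 2 / (freqNormSq (ℓ + (-1 : ℤ) • (fun i => (W.phase j).m i * (n : ℤ))) /
          freqNormSq (fun i => (W.phase j).m i * (n : ℤ)) - freqNormSq ℓ / freqNormSq (fun i => (W.phase j).m i * (n : ℤ))) +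
        (pf j 0 ⬝ᵥ pf j 1) ^ 2 / (freqNormSq (ℓ + (1 : ℤ) • (fun i => (W.phase j).m i * (n : ℤ))) /
          freqNormSq (fun i => (W.phase j).m i * (n : ℤ)) - freqNormSq ℓ / freqNormSq (fun i => (W.phase j).m i * (n : ℤ))))
    (hg₁ : ∀ j, g₁ j = 2 * Real.pi * (∑ i, (W.phase j).e i * (ℓ i : ℝ)) *
        ‖Complex.exp ((W.phase j).φ * Complex.I) *
          (1 / (2 * ((2 * Real.pi * ‖latticeVec (W.phase j).m‖ : ℝ) : ℂ) * Complex.I))‖ * (1 / (n : ℝ)) / Λ j)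
    (hσole : ∀ j, σo j ≤ σ j) (hσile : ∀ j, σi j ≤ σ j)
    (hGmax : ∀ q : ℕ, ∀ j, ∀ t ∈ Icc ((q : ℝ) * W.period + W.start j) ((q : ℝ) * W.period + W.start j + (W.phase j).τ), wa q j t ≤ Gmax ∧ wb q j t ≤ Gmax ∧ ‖wc q j t‖ ≤ Gmax)
    (hG : ∀ q : ℕ, ∀ j, ∀ t ∈ Icc ((q : ℝ) * W.period + W.start j) ((q : ℝ) * W.period + W.start j + (W.phase j).τ), ∀ y₁ y₂ : ℂ,
      Gmin * (‖y₁‖ ^ 2 + ‖y₂‖ ^ 2) ≤ wa q j t * ‖y₁‖ ^ 2 + wb q j t * ‖y₂‖ ^ 2 + 2 * (wc q j t * conj y₁ * y₂).re)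
    (hβ' : ∀ j, 16 * Gmax ^ 2 * g₁ j ^ 2 * Λ j * 2 ≤ Gmin * ε * lam * β * Δ)
    (hsmall : ∀ j, g₁ j ^ 2 * (4 * 2 / Δ) + 2 * lam / Λ j ≤ Δ)
    (hwa : ∀ q : ℕ, ∀ j, ∀ t ∈ Icc ((q : ℝ) * W.period + W.start j) ((q : ℝ) * W.period + W.start j + (W.phase j).τ),
      HasDerivWithinAt (wa q j) ((2 * (Λ j * (freqNormSq ℓ / freqNormSq (fun i => (W.phase j).m i * (n : ℤ)) +
          (g₁ j * LatticeWord.trapezoid 0 (W.phase j).τ W.ramp (t - ((q : ℝ) * W.period + W.start j))) ^ 2 * σo j) - lam)) *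
        wa q j t) (Icc ((q : ℝ) * W.period + W.start j) ((q : ℝ) * W.period + W.start j + (W.phase j).τ)) t)
    (hwb : ∀ q : ℕ, ∀ j, ∀ t ∈ Icc ((q : ℝ) * W.period + W.start j) ((q : ℝ) * W.period + W.start j + (W.phase j).τ),
      HasDerivWithinAt (wb q j) ((2 * (Λ j * (freqNormSq ℓ / freqNormSq (fun i => (W.phase j).m i * (n : ℤ)) +
          (g₁ j * LatticeWord.trapezoid 0 (W.phase j).τ W.ramp (t - ((q : ℝ) * W.period + W.start j))) ^ 2 * σi j) - lam)) *
        wb q j t) (Icc ((q : ℝ) * W.period + W.start j) ((q : ℝ) * W.period + W.start j + (W.phase j).τ)) t)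
    (hwc : ∀ q : ℕ, ∀ j, ∀ t ∈ Icc ((q : ℝ) * W.period + W.start j) ((q : ℝ) * W.period + W.start j + (W.phase j).τ),
      HasDerivWithinAt (wc q j) ((((Λ j * (freqNormSq ℓ / freqNormSq (fun i => (W.phase j).m i * (n : ℤ)) +
            (g₁ j * LatticeWord.trapezoid 0 (W.phase j).τ W.ramp (t - ((q : ℝ) * W.period + W.start j))) ^ 2 * σo j) +
          Λ j * (freqNormSq ℓ / freqNormSq (fun i => (W.phase j).m i * (n : ℤ)) +
            (g₁ j * LatticeWord.trapezoid 0 (W.phase j).τ W.ramp (t - ((q : ℝ) * W.period + W.start j))) ^ 2 * σi j) -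
          2 * lam : ℝ) : ℂ) * wc q j t))
        (Icc ((q : ℝ) * W.period + W.start j) ((q : ℝ) * W.period + W.start j + (W.phase j).τ)) t)
    (hjunc : ∀ q : ℕ, ∀ j : Fin k₀, ∀ hj : j.val + 1 < k₀, ∀ u : EuclideanSpace ℂ (Fin 3),
      (fun i => ((ℓ i : ℤ) : ℂ)) ⬝ᵥ WithLp.ofLp u = 0 →
        wa q ⟨j.val + 1, hj⟩ ((q : ℝ) * W.period + W.start ⟨j.val + 1, hj⟩) * ‖inner ℂ (WithLp.toLp 2 (Complex.ofReal ∘ ζr ⟨j.val + 1, hj⟩) : EuclideanSpace ℂ (Fin 3)) u‖ ^ 2 +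
          wb q ⟨j.val + 1, hj⟩ ((q : ℝ) * W.period + W.start ⟨j.val + 1, hj⟩) * ‖inner ℂ (WithLp.toLp 2 (Complex.ofReal ∘ pf ⟨j.val + 1, hj⟩ 0) : EuclideanSpace ℂ (Fin 3)) u‖ ^ 2 +
          2 * (wc q ⟨j.val + 1, hj⟩ ((q : ℝ) * W.period + W.start ⟨j.val + 1, hj⟩) * conj (inner ℂ (WithLp.toLp 2 (Complex.ofReal ∘ ζr ⟨j.val + 1, hj⟩) : EuclideanSpace ℂ (Fin 3)) u) * inner ℂ (WithLp.toLp 2 (Complex.ofReal ∘ pf ⟨j.val + 1, hj⟩ 0) : EuclideanSpace ℂ (Fin 3)) u).re ≤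
        wa q j ((q : ℝ) * W.period + W.start j + (W.phase j).τ) * ‖inner ℂ (WithLp.toLp 2 (Complex.ofReal ∘ ζr j) : EuclideanSpace ℂ (Fin 3)) u‖ ^ 2 +
          wb q j ((q : ℝ) * W.period + W.start j + (W.phase j).τ) * ‖inner ℂ (WithLp.toLp 2 (Complex.ofReal ∘ pf j 0) : EuclideanSpace ℂ (Fin 3)) u‖ ^ 2 +
          2 * (wc q j ((q : ℝ) * W.period + W.start j + (W.phase j).τ) * conj (inner ℂ (WithLp.toLp 2 (Complex.ofReal ∘ ζr j) : EuclideanSpace ℂ (Fin 3)) u) * inner ℂ (WithLp.toLp 2 (Complex.ofReal ∘ pf j 0) : EuclideanSpace ℂ (Fin 3)) u).re)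
    (hstart : ∀ q : ℕ, ∀ u : EuclideanSpace ℂ (Fin 3), (fun i => ((ℓ i : ℤ) : ℂ)) ⬝ᵥ WithLp.ofLp u = 0 →
        wa q ⟨0, W.pos⟩ ((q : ℝ) * W.period + W.start ⟨0, W.pos⟩) * ‖inner ℂ (WithLp.toLp 2 (Complex.ofReal ∘ ζr ⟨0, W.pos⟩) : EuclideanSpace ℂ (Fin 3)) u‖ ^ 2 +
          wb q ⟨0, W.pos⟩ ((q : ℝ) * W.period + W.start ⟨0, W.pos⟩) * ‖inner ℂ (WithLp.toLp 2 (Complex.ofReal ∘ pf ⟨0, W.pos⟩ 0) : EuclideanSpace ℂ (Fin 3)) u‖ ^ 2 +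
          2 * (wc q ⟨0, W.pos⟩ ((q : ℝ) * W.period + W.start ⟨0, W.pos⟩) * conj (inner ℂ (WithLp.toLp 2 (Complex.ofReal ∘ ζr ⟨0, W.pos⟩) : EuclideanSpace ℂ (Fin 3)) u) * inner ℂ (WithLp.toLp 2 (Complex.ofReal ∘ pf ⟨0, W.pos⟩ 0) : EuclideanSpace ℂ (Fin 3)) u).re ≤ ‖u‖ ^ 2)
    (hend : ∀ q : ℕ, ∀ u : EuclideanSpace ℂ (Fin 3), (fun i => ((ℓ i : ℤ) : ℂ)) ⬝ᵥ WithLp.ofLp u = 0 →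
        ‖u‖ ^ 2 ≤ wa q ⟨k₀ - 1, Nat.sub_lt W.pos one_pos⟩ ((q : ℝ) * W.period + W.start ⟨k₀ - 1, Nat.sub_lt W.pos one_pos⟩ + (W.phase ⟨k₀ - 1, Nat.sub_lt W.pos one_pos⟩).τ) * ‖inner ℂ (WithLp.toLp 2 (Complex.ofReal ∘ ζr ⟨k₀ - 1, Nat.sub_lt W.pos one_pos⟩) : EuclideanSpace ℂ (Fin 3)) u‖ ^ 2 +
          wb q ⟨k₀ - 1, Nat.sub_lt W.pos one_pos⟩ ((q : ℝ) * W.period + W.start ⟨k₀ - 1, Nat.sub_lt W.pos one_pos⟩ + (W.phase ⟨k₀ - 1, Nat.sub_lt W.pos one_pos⟩).τ) * ‖inner ℂ (WithLp.toLp 2 (Complex.ofReal ∘ pf ⟨k₀ - 1, Nat.sub_lt W.pos one_pos⟩ 0) : EuclideanSpace ℂ (Fin 3)) u‖ ^ 2 +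
          2 * (wc q ⟨k₀ - 1, Nat.sub_lt W.pos one_pos⟩ ((q : ℝ) * W.period + W.start ⟨k₀ - 1, Nat.sub_lt W.pos one_pos⟩ + (W.phase ⟨k₀ - 1, Nat.sub_lt W.pos one_pos⟩).τ) * conj (inner ℂ (WithLp.toLp 2 (Complex.ofReal ∘ ζr ⟨k₀ - 1, Nat.sub_lt W.pos one_pos⟩) : EuclideanSpace ℂ (Fin 3)) u) * inner ℂ (WithLp.toLp 2 (Complex.ofReal ∘ pf ⟨k₀ - 1, Nat.sub_lt W.pos one_pos⟩ 0) : EuclideanSpace ℂ (Fin 3)) u).re)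
    (hΘ : ∀ j, max (Real.exp (-(8 * Real.pi ^ 2 * κ * ((n : ℝ) / 2) ^ 2) * (W.phase j).τ))
        (Real.exp (-(2 * (1 - ε) * lam * (W.phase j).τ) +
          (40 * β * 2 * Λ j * (W.phase j).τ * g₁ j ^ 4 * (1 + g₁ j ^ 2 * σ j ^ 2) / Δ ^ 3 +
            48 * β * 2 * g₁ j ^ 2 / (W.ramp * (W.phase j).τ * Λ j * Δ ^ 3)) / Gmin)) ≤ Θ j)
    (hΘ1 : ∏ j, Θ j ≤ 1) (hΘ0 : 0 < ∏ j, Θ j)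
    {T : ℝ} (hT : 0 < T) {w : ℝ → UnitAddTorus (Fin 3) → EuclideanSpace ℝ (Fin 3)}
    (hw : Torus.IsWeakPassiveVectorOn 0 T κ (W.cell n) w₀ w) :
    ∀ᵐ t ∂(volume.restrict (Ioo 0 T)), ∫ x, ‖w t x‖ ^ 2 ≤
      β * (∏ j, Θ j)⁻¹ * Real.exp (-(Real.log (∏ j, Θ j)⁻¹ / W.period) * t) * ∫ x, ‖w₀ x‖ ^ 2 := by
  classical
  set hPV := pvSetup_cell W hn hκ.le ℓ hw₀ hdiv hmean hsupp with hPVdef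
  have hK0 : ∀ j : Fin k₀, (fun i => (W.phase j).m i * (n : ℤ)) ≠ 0 := fun j => cellFreq_ne_zero (W.phase j) hn
  have hβ0 : 0 ≤ β := zero_le_one.trans hβ
  have hE0 : 0 ≤ ∫ x, ‖w₀ x‖ ^ 2 := integral_nonneg fun x => by positivity
  -- eventually in `N`: the carrier and `ℓ + J•K_j`, `J ∈ {0, ±1}`, are resolved for every slot
  have hev : ∀ᶠ N : ℕ in atTop, (Finset.univ.biUnion fun j : Fin k₀ =>
        ({(fun i => (W.phase j).m i * n), -(fun i => (W.phase j).m i * n)} : Finset (Fin 3 → ℤ))) ⊆ freqBall N ∧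
      ∀ j : Fin k₀, ℓ + (0 : ℤ) • (fun i => (W.phase j).m i * (n : ℤ)) ∈ freqBall N ∧
        ℓ + (1 : ℤ) • (fun i => (W.phase j).m i * (n : ℤ)) ∈ freqBall N ∧
        ℓ + (-1 : ℤ) • (fun i => (W.phase j).m i * (n : ℤ)) ∈ freqBall N := by
    have h1 : ∀ᶠ N : ℕ in atTop, ∀ k ∈ (Finset.univ.biUnion fun j : Fin k₀ =>
        ({(fun i => (W.phase j).m i * n), -(fun i => (W.phase j).m i * n)} : Finset (Fin 3 → ℤ))), k ∈ freqBall N :=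
      (Filter.eventually_all_finset _).2 fun k _ => eventually_mem_freqBall k
    have h2 : ∀ᶠ N : ℕ in atTop, ∀ j : Fin k₀, ℓ + (0 : ℤ) • (fun i => (W.phase j).m i * (n : ℤ)) ∈ freqBall N ∧
        ℓ + (1 : ℤ) • (fun i => (W.phase j).m i * (n : ℤ)) ∈ freqBall N ∧
        ℓ + (-1 : ℤ) • (fun i => (W.phase j).m i * (n : ℤ)) ∈ freqBall N := by
      refine Filter.eventually_all.2 fun j => ?_
      filter_upwards [eventually_mem_freqBall (ℓ + (0 : ℤ) • (fun i => (W.phase j).m i * (n : ℤ))),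
        eventually_mem_freqBall (ℓ + (1 : ℤ) • (fun i => (W.phase j).m i * (n : ℤ))),
        eventually_mem_freqBall (ℓ + (-1 : ℤ) • (fun i => (W.phase j).m i * (n : ℤ)))] with N ha hb hc
      exact ⟨ha, hb, hc⟩
    filter_upwards [h1, h2] with N hN hN2
    exact ⟨fun k hk' => hN k hk', hN2⟩
  -- the uniform bound on the truncations
  have hΦ : ∀ᶠ N in atTop, ∀ t, 0 ≤ t →
      ∑ k, ‖hPV.galerkinCoeff N t k‖ ^ 2 ≤
        β * (∏ j, Θ j)⁻¹ * Real.exp (-(Real.log (∏ j, Θ j)⁻¹ / W.period) * t) * ∫ x, ‖w₀ x‖ ^ 2 := by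
    filter_upwards [hev] with N hN
    intro t ht
    obtain ⟨hBN, hres⟩ := hN
    -- the index segments of the principal cosets, slot by slot
    have hWex : ∀ j : Fin k₀, ∃ Wset : Finset ℤ,
        ∀ J : ℤ, J ∈ Wset ↔ ℓ + J • (fun i => (W.phase j).m i * (n : ℤ)) ∈ freqBall N :=
      fun j => exists_cosetIndexSet (hK0 j) ℓ N
    choose Wset hW using hWex
    have hdec := isoSector_exp_decay W hn hκ ℓ hℓn hw₀ hdiv hmean hsupp hBN (fun j J _ => hk j J) hdisj ζr hζ1 hζ0 hζK
      pf hp Wset hW (fun j => (hW j 0).2 (hres j).1) (fun j => (hW j 1).2 (hres j).2.1)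
      (fun j => (hW j (-1)).2 (hres j).2.2) (fun j J _ => hs j J) Λ σo σi σ g₁ Θ Δ ε β lam Gmax Gmin wa wb wc hΛ hΔ0 hε hβ
      hlam hGmin (fun j J _ hJ0 => hgap j J hJ0) hσo hσi hg₁ hσole hσile hGmax hG hβ' hsmall hwa hwb hwc hjunc hstart hend
      hΘ hΘ1 hΘ0 ht
    -- identify the sums
    have hsum : ∀ τ, ∑ k ∈ freqBall N, ‖hPV.galerkinCoeffAt N τ k‖ ^ 2 = ∑ k, ‖hPV.galerkinCoeff N τ k‖ ^ 2 := by
      intro τ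
      rw [← Finset.sum_coe_sort]
      exact Finset.sum_congr rfl fun k _ => by rw [Torus.PVSetup.galerkinCoeffAt, coeffExt_coe]
    rw [hsum t, hsum 0] at hdec
    have hinit : ∑ k, ‖hPV.galerkinCoeff N 0 k‖ ^ 2 ≤ ∫ x, ‖w₀ x‖ ^ 2 := hPV.sum_norm_sq_galerkinCoeff_le N le_rfl
    have hfac : 0 ≤ β * (∏ j, Θ j)⁻¹ * Real.exp (-(Real.log (∏ j, Θ j)⁻¹ / W.period) * t) := by
      have : 0 ≤ (∏ j, Θ j)⁻¹ := inv_nonneg.2 hΘ0.le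
      positivity
    exact hdec.trans (mul_le_mul_of_nonneg_left hinit hfac)
  exact ae_integral_norm_sq_le_of_galerkinBound W hn hκ ℓ hw₀ hdiv hmean hsupp hΦ hT hw

end Summit.AnomalousDissipation.AnomalousDissipation.Theorems.SolenoidalFractalHomogenisation.RealisedQuasiStaticCellLaw

end
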